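import Summits.RiemannHypothesis.RiemannHypothesis.Theses.WeilSemilocal
import Summits.RiemannHypothesis.RiemannHypothesis.Theorems.HandoffDodgerSlabFourFamily
import HarnessLib

/-!
# Route WeilSemilocal — CLOSER of the crux `WallsSixtyKTwin` (stmt-RiemannHypothesis-19185) by the RH-free zero-dodger slabs

Cell `rh-explicit`, WEIL column, seats handoff-prove-2 gen13 (DODGER-DOWN lead; slabs `[12500, 6·10⁴)`, ATTEMPT-23) and dodger-p2 gen0
(window lever + slab `[7100, 12500)` + family glue). `WallsSixtyKTwin` says: for every lower-twin prime `10⁴ ≤ q < 6·10⁴` and every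
prime `q' > q`, `a*(S_q) < (log q')/2`. The dodger is GAP-BLIND, so the twin hypothesis is not even used: the glued family
`HandoffDodgerSlabFourFamily.classLaw_from_sevenThousandOneHundred` gives the sentence at EVERY prime `q ≥ 7100`.
RH-FREE upper clauses only; nothing here bears on the truth of RH.
-/

set_option linter.dupNamespace false

noncomputable section

namespace Summit.RiemannHypothesis.RiemannHypothesis.Theorems.WeilSemilocalRoute

open Summit.RiemannHypothesis.RiemannHypothesis.Theorems.Handoff

/-- **`WallsSixtyKTwin` (stmt-RiemannHypothesis-19185) holds**: C-I(a) at every lower-twin prime `10⁴ ≤ q < 6·10⁴`, from the RH-free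
dodger upper clause for every prime `q ≥ 7100` (the twin hypothesis is not used). [this cell, ATTEMPT-23; RH-FREE] -/
theorem wallsSixtyKTwin_proof :
    Summit.RiemannHypothesis.RiemannHypothesis.Theses.WeilSemilocal.WallsSixtyKTwin := by
  unfold Theses.WeilSemilocal.WallsSixtyKTwin
  intro q hq hlo _ _ q' hq' hlt
  exact classLaw_from_sevenThousandOneHundred hq (by omega) q' hq' hlt

end Summit.RiemannHypothesis.RiemannHypothesis.Theorems.WeilSemilocalRoute

end
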